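import Summits.AtomisticToContinuum.HydrodynamicLimit.Theorems.InformationPercolationEngineChaosClosesEulerReductionStrip
import HarnessLib

/-!
# Kinetic reduction (crux `ChaosClosesEuler`, stmt-AtomisticToContinuum-15141, line `Sketch`,
# stub `stub_kineticReduction`) — helper: the classical data of the reduction and its real bookkeeping

WHAT. (i) The deterministic constants the reduction reads off the classical hard-sphere Euler solution on a closed
time strip `[0, b₀]`, `b₀ < T`: one sup bound `Cu` of `∂ₜũ` and of all `∂ⱼũᵢ`, one sup bound `Cθ` of `θ̃, ∂ₜθ̃, ∇θ̃`, and
ONE joint modulus of continuity in `(s, x)` of the six fields `ũ, ∂ₜũ, ∇ũ, θ̃, ∂ₜθ̃, ∇θ̃` (`classical_data`; compactness).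
(ii) The elementary real inequalities turning the choices `x ≤ b/(K+1)` of the tolerances into the two smallness
conditions of the deterministic core (`mul_le_of_le_div`, `budget_momentum`, `budget_entropy`).

No named fact is invoked.
-/

noncomputable section

namespace Summit.AtomisticToContinuum.HydrodynamicLimit.Theorems.ChaosClosesEulerReduction

open scoped BigOperators Topology Classical InnerProductSpace
open Filter Set Function
open Literature.MathematicalPhysics.KineticTheory
open Literature.Analysis.FluidPDE
open Literature.Analysis.FunctionSpaces

/-! ## §1 Real bookkeeping -/

/-- `a ≤ b/(K+1)`, `0 ≤ a, K, b` give `a K ≤ b`. [folklore] -/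
theorem mul_le_of_le_div {a b K : ℝ} (hK : 0 ≤ K) (ha : 0 ≤ a) (h : a ≤ b / (K + 1)) : a * K ≤ b := by
  have hK1 : 0 < K + 1 := by linarith
  have h1 : a * (K + 1) ≤ b := (le_div_iff₀ hK1).1 h
  nlinarith

/-- **Registered sub-goal `stub_reductionClassical` (helper of `stub_kineticReduction`): the same with the factor on
the left**, `K a ≤ b`. [folklore] -/
theorem stub_reductionClassical : ∀ {a b K : ℝ}, 0 ≤ K → 0 ≤ b → 0 ≤ a → a ≤ b / (K + 1) → K * a ≤ b := by
  intro a b K hK _ ha h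
  rw [mul_comm]; exact mul_le_of_le_div hK ha h

/-- **The momentum budget.** Seven terms, each at most `δ/8`. [folklore] -/
theorem budget_momentum {δ ηW ηP B3 T4 T5 T6a T6b T6c T7 c : ℝ} (hδ : 0 ≤ δ)
    (h1 : ηW ≤ δ / 8) (h2 : ηP ≤ δ / 4) (h3 : B3 ≤ δ / 8) (h4 : T4 ≤ δ / 8) (h5 : T5 ≤ δ / 8)
    (h6a : c * T6a ≤ δ / 32) (h6b : c * T6b ≤ δ / 32) (h6c : c * T6c ≤ δ / 32) (h7 : T7 ≤ δ / 8) :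
    ηW + ηP / 2 + B3 + T4 + T5 + c * (T6a + T6b + T6c) + T7 ≤ δ := by
  have e : c * (T6a + T6b + T6c) = c * T6a + c * T6b + c * T6c := by ring
  linarith

/-- **The entropy budget.** Three terms, each at most `δ/4`. [folklore] -/
theorem budget_entropy {δ ηL E₁ E₂ : ℝ} (hδ : 0 ≤ δ) (h1 : ηL ≤ δ / 4) (h2 : E₁ ≤ δ / 4) (h3 : E₂ ≤ δ / 4) :
    ηL + E₁ + E₂ ≤ δ := by
  linarith

/-- A mesh below a positive level: for `c > 0` there is `n ≥ 1` with `L / n ≤ c`. [folklore] -/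
theorem exists_nat_mesh_le (L : ℝ) {c : ℝ} (hc : 0 < c) : ∃ n : ℕ, 1 ≤ n ∧ L / n ≤ c := by
  obtain ⟨n, hn⟩ := exists_nat_gt (max 1 (L / c))
  have hn1 : (1 : ℝ) < n := (le_max_left _ _).trans_lt hn
  have hn0 : (0 : ℝ) < n := by linarith
  refine ⟨n, by exact_mod_cast hn1.le, ?_⟩
  rw [div_le_iff₀ hn0]
  have h := (le_max_right _ _).trans_lt hn
  rw [div_lt_iff₀ hc] at h
  nlinarith

/-! ## §2 The classical data -/

/-- **A component of a partial derivative of a `C¹` vector field is bounded by the norm of the vector partial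
derivative.** [folklore] -/
theorem abs_partialDeriv_apply_le {u : T3 → V3} (hu : Torus.IsContDiff 1 u) (j i : Fin 3) (x : T3) :
    |Torus.partialDeriv j (fun y => u y i) x| ≤ ‖Torus.partialDeriv j u x‖ := by
  rw [partialDeriv_apply_eq hu j i x, ← Torus.partialDeriv_eq_fderiv_apply hu j x]
  simpa using PiLp.norm_apply_le (p := 2) (Torus.partialDeriv j u x) i

/-- **The gradient is bounded by the partial derivatives**: `‖∇f‖ ≤ ∑ₖ |∂ₖf|`. [folklore] -/
theorem norm_gradient_le_sum {f : T3 → ℝ} (hf : Torus.IsContDiff 1 f) (x : T3) :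
    ‖Torus.gradient f x‖ ≤ ∑ k : Fin 3, |Torus.partialDeriv k f x| := by
  rw [gradient_eq_sum_partialDeriv hf x]
  refine (norm_sum_le _ _).trans (Finset.sum_le_sum fun k _ => ?_)
  rw [norm_smul, Real.norm_eq_abs, PiLp.norm_single, norm_one, mul_one]

set_option maxHeartbeats 800000 in
/-- **The classical data on a closed time strip.** See the module docstring. [folklore] -/
theorem classical_data {T : ℝ} {u : ℝ → T3 → V3} {θ : ℝ → T3 → ℝ}
    (hu : Torus.IsSmoothSpaceTimeOn (Ico 0 T) u) (hθ : Torus.IsSmoothSpaceTimeOn (Ico 0 T) θ)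
    {b₀ : ℝ} (hb₀ : b₀ < T) :
    ∃ Cu Cθ : ℝ, 1 ≤ Cu ∧ 0 ≤ Cθ ∧
      (∀ s ∈ Icc 0 b₀, ∀ x, ‖Torus.timeDerivWithin (Ico 0 T) u s x‖ ≤ Cu) ∧
      (∀ s ∈ Icc 0 b₀, ∀ x, ∀ i j : Fin 3, |Torus.partialDeriv j (fun y => u s y i) x| ≤ Cu) ∧
      (∀ s ∈ Icc 0 b₀, ∀ x, |θ s x| ≤ Cθ) ∧
      (∀ s ∈ Icc 0 b₀, ∀ x, |Torus.timeDerivWithin (Ico 0 T) θ s x| ≤ Cθ) ∧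
      (∀ s ∈ Icc 0 b₀, ∀ x, ‖Torus.gradient (θ s) x‖ ≤ Cθ) ∧
      ∀ ω : ℝ, 0 < ω → ∃ d : ℝ, 0 < d ∧ ∀ s ∈ Icc 0 b₀, ∀ s' ∈ Icc 0 b₀, |s - s'| < d → ∀ x y : T3, Torus.euclidDist x y < d →
        ‖u s x - u s' y‖ ≤ ω ∧
        ‖Torus.timeDerivWithin (Ico 0 T) u s x - Torus.timeDerivWithin (Ico 0 T) u s' y‖ ≤ ω ∧
        (∀ i j : Fin 3, |Torus.partialDeriv j (fun y => u s y i) x - Torus.partialDeriv j (fun y' => u s' y' i) y| ≤ ω) ∧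
        |θ s x - θ s' y| ≤ ω ∧
        |Torus.timeDerivWithin (Ico 0 T) θ s x - Torus.timeDerivWithin (Ico 0 T) θ s' y| ≤ ω ∧
        ‖Torus.gradient (θ s) x - Torus.gradient (θ s') y‖ ≤ ω := by
  have hsT : ∀ s ∈ Icc 0 b₀, s ∈ Ico 0 T := fun s hs => ⟨hs.1, hs.2.trans_lt hb₀⟩
  -- sup bounds
  obtain ⟨Cu, hCu1, -, hut, hDu⟩ := exists_window_bound hu hb₀
  obtain ⟨C1, hC1, hθb, hθt, hDθ⟩ := exists_window_bound hθ hb₀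
  have hθx : ∀ s ∈ Icc 0 b₀, ∀ x, ‖Torus.gradient (θ s) x‖ ≤ 3 * C1 := fun s hs x => by
    refine (norm_gradient_le_sum (isContDiff_one_slice hθ (hsT s hs)) x).trans ?_
    calc ∑ k : Fin 3, |Torus.partialDeriv k (θ s) x| ≤ ∑ _k : Fin 3, C1 := Finset.sum_le_sum fun k _ => by
          have h := hDθ k s hs x; rwa [Real.norm_eq_abs] at h
      _ = 3 * C1 := by simp [Finset.sum_const, Finset.card_univ]
  -- the six fields, jointly continuous on the strip
  have hsub : Icc 0 b₀ ×ˢ (univ : Set T3) ⊆ Ico 0 T ×ˢ univ := prod_mono (fun s hs => hsT s hs) subset_rfl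
  obtain ⟨cu, -, cut', cD⟩ := velocity_factors hu le_rfl (by linarith : b₀ + 0 < T)
  obtain ⟨cθ, cθt, -, cθx⟩ := scalar_factors hθ le_rfl (by linarith : b₀ + 0 < T)
  simp only [add_zero] at cu cut' cD cθ cθt cθx
  have cDm : ContinuousOn (uncurry fun s x => fun i j => Torus.partialDeriv j (fun y => u s y i) x) (Icc 0 b₀ ×ˢ univ) :=
    continuousOn_pi.2 fun i => continuousOn_pi.2 fun j => cD i j
  refine ⟨Cu, 3 * C1, hCu1, by linarith, hut, fun s hs x i j =>
    (abs_partialDeriv_apply_le (isContDiff_one_slice hu (hsT s hs)) j i x).trans (hDu j s hs x),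
    fun s hs x => by have h := hθb s hs x; rw [Real.norm_eq_abs] at h; linarith,
    fun s hs x => by have h := hθt s hs x; rw [Real.norm_eq_abs] at h; linarith, hθx, fun ω hω => ?_⟩
  obtain ⟨d1, hd1, H1⟩ := exists_modulus cu hω
  obtain ⟨d2, hd2, H2⟩ := exists_modulus cut' hω
  obtain ⟨d3, hd3, H3⟩ := exists_modulus cDm hω
  obtain ⟨d4, hd4, H4⟩ := exists_modulus cθ hω
  obtain ⟨d5, hd5, H5⟩ := exists_modulus cθt hω
  obtain ⟨d6, hd6, H6⟩ := exists_modulus cθx hω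
  refine ⟨min (min d1 (min d2 d3)) (min d4 (min d5 d6)), by positivity, fun s hs s' hs' hss x y hxy => ?_⟩
  have m1 : min (min d1 (min d2 d3)) (min d4 (min d5 d6)) ≤ d1 := (min_le_left _ _).trans (min_le_left _ _)
  have m2 : min (min d1 (min d2 d3)) (min d4 (min d5 d6)) ≤ d2 := ((min_le_left _ _).trans (min_le_right _ _)).trans (min_le_left _ _)
  have m3 : min (min d1 (min d2 d3)) (min d4 (min d5 d6)) ≤ d3 := ((min_le_left _ _).trans (min_le_right _ _)).trans (min_le_right _ _)
  have m4 : min (min d1 (min d2 d3)) (min d4 (min d5 d6)) ≤ d4 := (min_le_right _ _).trans (min_le_left _ _)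
  have m5 : min (min d1 (min d2 d3)) (min d4 (min d5 d6)) ≤ d5 := ((min_le_right _ _).trans (min_le_right _ _)).trans (min_le_left _ _)
  have m6 : min (min d1 (min d2 d3)) (min d4 (min d5 d6)) ≤ d6 := ((min_le_right _ _).trans (min_le_right _ _)).trans (min_le_right _ _)
  refine ⟨(H1 s hs s' hs' (hss.trans_le m1) x y (hxy.trans_le m1)).le, (H2 s hs s' hs' (hss.trans_le m2) x y (hxy.trans_le m2)).le,
    fun i j => ?_, ?_, ?_, (H6 s hs s' hs' (hss.trans_le m6) x y (hxy.trans_le m6)).le⟩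
  · have h := (H3 s hs s' hs' (hss.trans_le m3) x y (hxy.trans_le m3)).le
    refine le_trans ?_ h
    have e1 : Torus.partialDeriv j (fun y => u s y i) x - Torus.partialDeriv j (fun y' => u s' y' i) y =
        ((fun i j => Torus.partialDeriv j (fun y => u s y i) x) - fun i j => Torus.partialDeriv j (fun y' => u s' y' i) y) i j := rfl
    rw [e1, ← Real.norm_eq_abs]
    exact (norm_le_pi_norm (((fun i j => Torus.partialDeriv j (fun y => u s y i) x) -
      fun i j => Torus.partialDeriv j (fun y' => u s' y' i) y) i) j).trans (norm_le_pi_norm _ i)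
  · have h := (H4 s hs s' hs' (hss.trans_le m4) x y (hxy.trans_le m4)).le
    rwa [Real.norm_eq_abs] at h
  · have h := (H5 s hs s' hs' (hss.trans_le m5) x y (hxy.trans_le m5)).le
    rwa [Real.norm_eq_abs] at h

end Summit.AtomisticToContinuum.HydrodynamicLimit.Theorems.ChaosClosesEulerReduction

end
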